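import Summits.ResolutionOfSingularities.ResolutionOfSingularities.Theorems.PurelyInseparableDim4PhiLineIsolation
import Literature.AlgebraicGeometry.Resolution.OriginLocalRing
import Literature.AlgebraicGeometry.Resolution.IsolationIndexed
import Literature.AlgebraicGeometry.Resolution.RsopMonomialIdeals
import HarnessLib
import HarnessLib.Audit.Tags

/-!
# Purely inseparable four-folds — the Φ-line, local form and polygon reading: an isolated state's residual has
# `α < 1` in every regular frame whose `u₁` is a critical boundary letter (cell `res-dim4-pi`, slice C residual B∞,
# bricks (K-Φ1′) + stub (3) of res-dim4-idea-1 g5's `Sketch.lean`)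

[OURS · counted 0 · cell `res-dim4-pi` · seat res-dim4-p-11 g3 · statements (K-Φ1′) `not_mem_primePow_loc_of_isIsolated` and
stub (3) `alphaS_lt_of_isIsolated` are res-dim4-idea-1 g5's (`pub/res-dim4/res-dim4-idea-1/lean-g5/Sketch.lean` ade7af20c994a8b6),
verbatim; desk WORD #122.]  Nothing here proves K2(p), `NoAboveFloorTrap`, or resolution of singularities in dimension ≥ 4 /
characteristic `p`.  AI kernel work, weaker than expert review.

* §1 (polynomial side, up to a unit) `not_unit_mul_mem_pow_of_isIsolated`: for an isolated `F = x^r·G`, a prime `P ⊊ 𝔪₀`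
  containing `x_h` with `p ≤ r_h + d`, and `t ∉ 𝔪₀`: `t·G ∉ P^d` (K1's `singLocusIdeal_le_colon_of_mul_mem_pow` peels the unit).
* §2 (K-Φ1′) `not_mem_primePow_loc_of_isIsolated`: in `𝒪 = K[x]_{𝔪₀} = OriginLocalization K 4`, for every prime `𝔮 ≠ 𝔪`
  containing `x_h`: `G ∉ 𝔮^d` — contract `𝔮` to `P = 𝔮 ∩ K[x]` and clear denominators (`G ∈ P^d·𝒪 ⇒ t·G ∈ P^d`, `t ∉ 𝔪₀`).
* §3 stub (3) `alphaS_lt_of_isIsolated`: for every regular system of parameters `c = (y₁, y₂, u₁, u₂)` of `𝒪` with `u₁ = x_h`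
  critical (`p ≤ r_h + d`): Newton points of `(G)` exist and `αs < d!` — `𝔮 = (y₁, y₂, u₁)` is a prime `≠ 𝔪` (part of a r.s.p.,
  `IsRsopPart.isPrime_span_range` / `not_mem_span_image`), so `(G) ⊄ 𝔮^d` by §2, and CJS Lemma 11.5
  (`WeightedOrder.alphaS_lt_of_not_le_yu1_pow`) reads the polygon.
[cite: CossartJannsenSaito2020, Lemma 11.5, Lemma 13.4 (3)] bears_on: LADDER-RESOLUTION:D157-DOOR2 (res-dim4-pi · slice C residual
B∞ · Φ line).  Supports stmt-ResolutionOfSingularities-16155 (helper).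
-/

set_option linter.dupNamespace false -- mandated namespace of this single-conjunct summit

noncomputable section

namespace Summit.ResolutionOfSingularities.ResolutionOfSingularities.Theorems.PIDim4

namespace PhiLine

open MvPolynomial Finset IsLocalRing
open Literature.AlgebraicGeometry.Resolution (OriginLocalization ringKrullDim_originLocalization IsRsopPart)
open Literature.AlgebraicGeometry.Resolution.WeightedOrder

variable {K : Type} [Field K]

/-! ## §1 Polynomial side, up to a unit at the origin -/

/-- If `t·F ∈ Pⁿ` with `p ≤ n`, `P` prime and `t ∉ P`, then `J_p⁺(F) ⊆ P` (K1: `t^p · J_p⁺(F) ⊆ P`). [folklore]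
[cite: CossartJannsenSaito2020, Lemma 13.4 (3)] -/
theorem singLocusIdeal_le_of_unit_mul_mem_pow {p n : ℕ} (hpn : p ≤ n) {P : Ideal (MvPolynomial (Fin 4) K)}
    (hP : P.IsPrime) {t F : MvPolynomial (Fin 4) K} (ht : t ∉ P) (hF : t * F ∈ P ^ n) :
    singLocusIdeal p F ≤ P := by
  intro g hg
  have h := IsolatedBand.singLocusIdeal_le_colon_of_mul_mem_pow P (Ideal.pow_le_pow_right hpn hF) hg
  rw [Submodule.mem_colon_singleton, smul_eq_mul] at h
  exact (hP.mem_or_mem h).resolve_right fun h' => ht (hP.mem_of_pow_mem _ h')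

/-- **(K-Φ1) up to a unit.**  For an isolated `F = x^r·G`, a prime `P ⊊ 𝔪₀` containing the letter `x_h` with `p ≤ r_h + d`,
and `t ∉ 𝔪₀`: `t·G ∉ P^d`. [cite: CossartJannsenSaito2020, Lemma 13.4 (3)] [folklore] -/
theorem not_unit_mul_mem_pow_of_isIsolated {p d : ℕ} {F G t : MvPolynomial (Fin 4) K} {r : Fin 4 →₀ ℕ}
    (hF : F = monomial r 1 * G) (hiso : IsIsolated p F) {P : Ideal (MvPolynomial (Fin 4) K)} (hP : P.IsPrime)
    (hPo : P ≤ originIdeal K) (hPne : P ≠ originIdeal K) {h : Fin 4} (hh : (X h : MvPolynomial (Fin 4) K) ∈ P)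
    (hd : p ≤ r h + d) (ht : t ∉ originIdeal K) : t * G ∉ P ^ d := by
  intro hG
  have htF : t * F ∈ P ^ (r h + d) := by
    rw [hF, mul_left_comm]
    exact monomial_mul_mem_pow_add hh r hG
  have hJ : singLocusIdeal p F ≤ P := singLocusIdeal_le_of_unit_mul_mem_pow hd hP (fun h' => ht (hPo h')) htF
  haveI := hP
  obtain ⟨Q, hQ, hQP⟩ := Ideal.exists_minimalPrimes_le hJ
  have hQo : Q = originIdeal K := hiso.2 Q hQ (hQP.trans hPo)
  exact hPne (le_antisymm hPo (hQo ▸ hQP))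

/-! ## §2 The local prime form in `𝒪 = K[x]_{𝔪₀}` -/

/-- The two spellings of `𝔪₀` agree: `ker (f ↦ f(0))` (`Literature…Resolution.originIdeal K 4`, the prime at which
`OriginLocalization K 4` localises) and `ker (eval 0)` (this cell's `originIdeal K`). [folklore] -/
theorem originIdeal_loc_eq : Literature.AlgebraicGeometry.Resolution.originIdeal K 4 = originIdeal K := by
  unfold originIdeal Literature.AlgebraicGeometry.Resolution.originIdeal
  rw [MvPolynomial.eval_zero]

/-- Clearing denominators: if `G ∈ I·𝒪` in `𝒪 = K[x]_{𝔪₀}` then `t·G ∈ I` for some `t ∉ 𝔪₀`. [folklore] -/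
theorem exists_unit_mul_mem_of_algebraMap_mem_map {I : Ideal (MvPolynomial (Fin 4) K)} {G : MvPolynomial (Fin 4) K}
    (hG : algebraMap (MvPolynomial (Fin 4) K) (OriginLocalization K 4) G ∈
      I.map (algebraMap (MvPolynomial (Fin 4) K) (OriginLocalization K 4))) :
    ∃ t : MvPolynomial (Fin 4) K, t ∉ originIdeal K ∧ t * G ∈ I := by
  obtain ⟨⟨i, s⟩, his⟩ :=
    (IsLocalization.mem_map_algebraMap_iff (Literature.AlgebraicGeometry.Resolution.originIdeal K 4).primeCompl
      (OriginLocalization K 4)).mp hG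
  rw [← map_mul] at his
  obtain ⟨c, hc⟩ :=
    (IsLocalization.eq_iff_exists (Literature.AlgebraicGeometry.Resolution.originIdeal K 4).primeCompl
      (OriginLocalization K 4)).mp his
  refine ⟨c * s, fun hmem => ?_, ?_⟩
  · rw [← originIdeal_loc_eq] at hmem
    exact ((Literature.AlgebraicGeometry.Resolution.originIdeal K 4).primeCompl.mul_mem c.prop s.prop) hmem
  · rw [mul_assoc, mul_comm (s : MvPolynomial (Fin 4) K) G, hc]
    exact Ideal.mul_mem_left _ _ i.prop

/-- **(K-Φ1′), LOCAL PRIME FORM** (res-dim4-idea-1 g5's stub, verbatim).  In `𝒪 = 𝒪_{𝔸⁴,0} = OriginLocalization K 4`: for an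
isolated `F = x^r·G`, a critical letter `x_h` (`p ≤ r_h + d`) and every prime `𝔮 ≠ 𝔪` of `𝒪` containing `x_h`, the residual `G`
is not in `𝔮^d`.  Covers re-adapted frames: `𝔮 = (y₁, y₂, u₁)𝒪` for every r.s.p. `(y₁, y₂, u₁ = x_h, u₂)`.
[cite: CossartJannsenSaito2020, Lemma 13.4 (3)] [folklore] -/
theorem not_mem_primePow_loc_of_isIsolated {p d : ℕ} {F G : MvPolynomial (Fin 4) K} {r : Fin 4 →₀ ℕ}
    (hF : F = monomial r 1 * G) (hiso : IsIsolated p F) {h : Fin 4} (hd : p ≤ r h + d)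
    {𝔮 : Ideal (OriginLocalization K 4)} (h𝔮 : 𝔮.IsPrime) (h𝔮ne : 𝔮 ≠ maximalIdeal (OriginLocalization K 4))
    (hh : algebraMap (MvPolynomial (Fin 4) K) (OriginLocalization K 4) (X h) ∈ 𝔮) :
    algebraMap (MvPolynomial (Fin 4) K) (OriginLocalization K 4) G ∉ 𝔮 ^ d := by
  intro hG
  -- the contraction `P = 𝔮 ∩ K[x]`: a prime with `x_h ∈ P ⊊ 𝔪₀`
  haveI := h𝔮
  have hPprime : (𝔮.under (MvPolynomial (Fin 4) K)).IsPrime := Ideal.IsPrime.under _ _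
  have hPo : 𝔮.under (MvPolynomial (Fin 4) K) ≤ originIdeal K := by
    have h1 : 𝔮.under (MvPolynomial (Fin 4) K) ≤ (maximalIdeal (OriginLocalization K 4)).under (MvPolynomial (Fin 4) K) :=
      Ideal.comap_mono (IsLocalRing.le_maximalIdeal h𝔮.ne_top)
    rw [Localization.AtPrime.under_maximalIdeal] at h1
    exact h1.trans originIdeal_loc_eq.le
  have hPne : 𝔮.under (MvPolynomial (Fin 4) K) ≠ originIdeal K := by
    intro hPeq
    apply h𝔮ne
    rw [← IsLocalization.map_under (Literature.AlgebraicGeometry.Resolution.originIdeal K 4).primeCompl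
      (OriginLocalization K 4) 𝔮, hPeq, ← originIdeal_loc_eq,
      IsLocalization.AtPrime.map_eq_maximalIdeal (Literature.AlgebraicGeometry.Resolution.originIdeal K 4)
        (OriginLocalization K 4)]
  have hXh : (X h : MvPolynomial (Fin 4) K) ∈ 𝔮.under (MvPolynomial (Fin 4) K) := Ideal.mem_comap.mpr hh
  -- clear denominators: `t · G ∈ P^d` with `t ∉ 𝔪₀`
  have hGd : algebraMap (MvPolynomial (Fin 4) K) (OriginLocalization K 4) G ∈
      ((𝔮.under (MvPolynomial (Fin 4) K)) ^ d).map (algebraMap (MvPolynomial (Fin 4) K) (OriginLocalization K 4)) := by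
    rw [Ideal.map_pow, IsLocalization.map_under (Literature.AlgebraicGeometry.Resolution.originIdeal K 4).primeCompl
      (OriginLocalization K 4) 𝔮]
    exact hG
  obtain ⟨t, ht, htG⟩ := exists_unit_mul_mem_of_algebraMap_mem_map hGd
  exact not_unit_mul_mem_pow_of_isIsolated hF hiso hPprime hPo hPne hXh hd ht htG

/-! ## §3 The polygon reading: `α < 1` in every regular frame with `u₁ = x_h` critical -/

/-- A family generating the maximal ideal of `𝒪_{𝔸⁴,0}` with `4` members is a regular system of parameters
(`dim 𝒪 = 4`). [folklore] -/
theorem isRsopPart_of_span_eq (c : Fin (2 + 2) → OriginLocalization K 4)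
    (hgen : Ideal.span (Set.range c) = maximalIdeal (OriginLocalization K 4)) : IsRsopPart c := by
  refine ⟨inferInstance, 0, Fin.elim0, ?_, ?_⟩
  · rw [ringKrullDim_originLocalization]
  · rw [← hgen, Set.range_eq_empty Fin.elim0, Set.union_empty]

/-- The frame indices `(y₁, y₂, u₁)` as an injection `Fin 3 → Fin 4`. [folklore] -/
theorem cons_u1_castAdd_injective : Function.Injective (Fin.cons (u1 2) (Fin.castAdd 2) : Fin 3 → Fin (2 + 2)) := by
  refine Fin.cons_injective_iff.mpr ⟨?_, Fin.castAdd_injective 2 2⟩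
  rintro ⟨i, hi⟩
  have h1 := congrArg Fin.val hi
  simp only [Fin.val_castAdd, u1, Fin.val_natAdd] at h1
  have := i.isLt
  omega

/-- `(y₁, y₂, u₁) = (c ∘ ι)` for the injection `ι = (u₁; y₁, y₂)`. [folklore] -/
theorem yu1Ideal_eq_span_range_comp (c : Fin (2 + 2) → OriginLocalization K 4) :
    yu1Ideal c = Ideal.span (Set.range (c ∘ (Fin.cons (u1 2) (Fin.castAdd 2) : Fin 3 → Fin (2 + 2)))) := by
  rw [yu1Ideal, Set.range_comp, Fin.range_cons, Set.image_insert_eq, ← Set.range_comp]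
  rfl

/-- For a regular system of parameters `c = (y₁, y₂, u₁, u₂)` of `𝒪_{𝔸⁴,0}`: `(y₁, y₂, u₁)` is a prime ideal.
[cite: Matsumura1987, Thm. 14.3] [folklore] -/
theorem isPrime_yu1Ideal (c : Fin (2 + 2) → OriginLocalization K 4)
    (hgen : Ideal.span (Set.range c) = maximalIdeal (OriginLocalization K 4)) : (yu1Ideal c).IsPrime := by
  rw [yu1Ideal_eq_span_range_comp]
  exact ((isRsopPart_of_span_eq c hgen).comp _ cons_u1_castAdd_injective).isPrime_span_range

/-- … and `(y₁, y₂, u₁) ≠ 𝔪` (it misses `u₂`). [cite: Matsumura1987, Thm. 14.2] [folklore] -/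
theorem yu1Ideal_ne_maximalIdeal (c : Fin (2 + 2) → OriginLocalization K 4)
    (hgen : Ideal.span (Set.range c) = maximalIdeal (OriginLocalization K 4)) :
    yu1Ideal c ≠ maximalIdeal (OriginLocalization K 4) := by
  intro heq
  have hu2 : u2 2 ∉ Set.range (Fin.cons (u1 2) (Fin.castAdd 2) : Fin 3 → Fin (2 + 2)) := by
    rintro ⟨j, hj⟩
    refine Fin.cases ?_ (fun i hi => ?_) j hj
    · intro h0
      rw [Fin.cons_zero] at h0
      exact absurd (congrArg Fin.val h0) (by simp [u1, u2])
    · rw [Fin.cons_succ] at hi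
      have h1 := congrArg Fin.val hi
      simp only [Fin.val_castAdd, u2, Fin.val_natAdd] at h1
      have := i.isLt
      omega
  refine (isRsopPart_of_span_eq c hgen).not_mem_span_image hu2 ?_
  rw [← Set.range_comp, ← yu1Ideal_eq_span_range_comp, heq, ← hgen]
  exact Ideal.subset_span ⟨u2 2, rfl⟩

/-- **(K-Φ1), POLYGON READING** (res-dim4-idea-1 g5's stub (3), verbatim).  In `𝒪_{𝔸⁴,0} = OriginLocalization K 4`, for ANY
regular system of parameters `c = (y₁, y₂, u₁, u₂)` whose `u₁` is the critical letter `x_h` (`p ≤ r_h + d`) of an isolated state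
`F = x^r·G`: Newton points of `(G)` exist and `αs < d!` (i.e. `α_h < 1`) — by (K-Φ1′) for `𝔮 = (y₁, y₂, u₁)` and CJS Lemma 11.5
(`WeightedOrder.alphaS_lt_of_not_le_yu1_pow`).  This is the `hα` input of `keepCount_add_betaS_le` at every KEEP-h step.
[cite: CossartJannsenSaito2020, Lemma 11.5, Lemma 13.4 (3)] [folklore] -/
theorem alphaS_lt_of_isIsolated {p d : ℕ} {F G : MvPolynomial (Fin 4) K} {r : Fin 4 →₀ ℕ}
    (hF : F = monomial r 1 * G) (hiso : IsIsolated p F) {h : Fin 4} (hd : p ≤ r h + d)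
    (c : Fin (2 + 2) → OriginLocalization K 4)
    (hgen : Ideal.span (Set.range c) = maximalIdeal (OriginLocalization K 4))
    (hu1 : c (u1 2) = algebraMap (MvPolynomial (Fin 4) K) (OriginLocalization K 4) (X h)) :
    (pts c (Ideal.span {algebraMap (MvPolynomial (Fin 4) K) (OriginLocalization K 4) G}) d).Nonempty ∧
      alphaS c (Ideal.span {algebraMap (MvPolynomial (Fin 4) K) (OriginLocalization K 4) G}) d < d.factorial := by
  have hdim : ringKrullDim (OriginLocalization K 4) = (2 : ℕ) + 2 := by
    rw [ringKrullDim_originLocalization]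
    rfl
  refine alphaS_lt_of_not_le_yu1_pow c hgen hdim fun hle => ?_
  have hh : algebraMap (MvPolynomial (Fin 4) K) (OriginLocalization K 4) (X h) ∈ yu1Ideal c := by
    rw [← hu1]
    exact Ideal.subset_span (Set.mem_insert _ _)
  exact not_mem_primePow_loc_of_isIsolated hF hiso hd (isPrime_yu1Ideal c hgen) (yu1Ideal_ne_maximalIdeal c hgen) hh
    (hle (Ideal.mem_span_singleton_self _))

end PhiLine

end Summit.ResolutionOfSingularities.ResolutionOfSingularities.Theorems.PIDim4

end
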